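import Mathlib
import Summits.MatrixMultiplication.MatrixMultiplication.Theorems.FidelityWitnessesFidelityGapTwoSixExplicitFrameB
import Summits.MatrixMultiplication.MatrixMultiplication.Theorems.FidelityWitnessesFidelityGapTwoSixExplicitLemmaA
import Summits.MatrixMultiplication.MatrixMultiplication.Theorems.FidelityWitnessesFidelityGapTwoSixExplicitSymmetry
import Literature.Computability.AlgebraicComplexity.TensorApolarityForms

/-!
# `FidelityGapTwoSixExplicit` — the A-side and B-side structure theorems of a `10`-plane

Part of the proof of `FidelityWitnesses.FidelityGapTwoSixExplicit` (stmt-MatrixMultiplication-14041); see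
`FidelityWitnessesFidelityGapTwoSixExplicitDefs.lean` for the line of argument.  Here the pieces are put
together for a `10`-plane `F` of slice defect `θ ≤ 10⁻⁴`: `dim F·A* ≤ 34` puts the missing plane
`annT ⊓ perpTo F` within `1/√50` of the frame `(u_i ⊗ ĥ)_i` (`aside`), and `dim F·B* ≤ 34` — the A-side
for `F^σ`, transported back by `sigmaV` — within `1/√50` of the frame `(σ(u_w ⊗ ĥ'))_w` (`bside`).
-/

noncomputable section

namespace Summit.MatrixMultiplication.MatrixMultiplication.Theorems.GapTwoSixExplicit

-- single-conjunct summit: the `Summit.<S>.<P>` prefix repeats `MatrixMultiplication` by design (D-0017)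
set_option linter.dupNamespace false

open scoped BigOperators ComplexConjugate InnerProductSpace
open Literature.Computability.AlgebraicComplexity Module

/-! ## The two one-sided structure theorems for a `10`-plane `F` -/

/-- **A-side.**  If `F` is a `10`-plane of bilinear forms with `dim F·A* ≤ 34` whose elements have
slice defect `≤ θ ≤ 10⁻⁴` against `T`, then the missing plane `annT ⊓ perpTo F` is within `1/√50`
of `U ⊗ ĥ` for a unit `ĥ`:  `‖ℓ‖² − Σ_i |⟪u_i ⊗ ĥ, ℓ⟫|² ≤ ‖ℓ‖²/50`. [folklore] -/
theorem aside {F : Submodule ℂ (P2 × P2 → ℂ)} {θ : ℝ}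
    (hF10 : finrank ℂ F = 10) (hA : finrank ℂ (TensorApolarity.prodA F) ≤ 34)
    (hθ : ∀ f ∈ F, (∑ c : P2, ‖∑ p : P2 × P2, f p * T2 c p.1 p.2‖ ^ 2) ≤ θ * ∑ p, ‖f p‖ ^ 2)
    (hθ0 : 0 ≤ θ) (hθ1 : θ ≤ 1 / 10000) :
    ∃ ĥ : V8, ‖ĥ‖ = 1 ∧ ∀ ℓ ∈ (annT ⊓ perpTo F : Submodule ℂ V16),
      ‖ℓ‖ ^ 2 - ∑ i : Fin 2, ‖⟪uTensor i ĥ, ℓ⟫_ℂ‖ ^ 2 ≤ 1 / 50 * ‖ℓ‖ ^ 2 := by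
  have hθ2 : 2 * θ < 1 := by linarith
  obtain ⟨Y, hYK, hY6, hrow⟩ := exists_plane_of_frame hF10 hA hθ hθ0 hθ2
  set L : Submodule ℂ V16 := annT ⊓ perpTo F with hLdef
  have hL : L ≤ annT := inf_le_left
  have hL0 : L ≠ ⊥ := by
    intro h
    have h2 := two_le_finrank_missing hF10
    rw [← hLdef, h, finrank_bot] at h2
    omega
  have hδ0 : 0 ≤ 2 * θ / (1 - 2 * θ) := div_nonneg (by linarith) (by linarith)
  have hδ : 2 * θ / (1 - 2 * θ) ≤ 1 / 4800 := by
    rw [div_le_iff₀ (by linarith)]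
    linarith
  have hrow' : ∀ ℓ ∈ L, ∀ i v : Fin 2,
      ‖Y.starProjection (rowVec (hComp i ℓ) v)‖ ^ 2 ≤ 2 * θ / (1 - 2 * θ) * ‖ℓ‖ ^ 2 :=
    fun ℓ hℓ i v => hrow ℓ hℓ.2 i v
  obtain ⟨ĥ, -, hĥ1, hmain⟩ := exists_unit_near_of_rows hYK hY6 hL hL0 hδ0 hδ hrow'
  refine ⟨ĥ, hĥ1, fun ℓ hℓ => ?_⟩
  have h := hmain ℓ hℓ
  simp only [inner_uTensor]
  exact h

/-- **B-side** (the A-side for `F^σ`, transported back).  Under `dim F·B* ≤ 34` the missing plane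
is within `1/√50` of `h̃ ⊗ W*`, i.e. of the pair `sigmaV (u_w ⊗ ĥ')`:
`‖ℓ‖² − Σ_w |⟪σ(u_w ⊗ ĥ'), ℓ⟫|² ≤ ‖ℓ‖²/50`. [folklore] -/
theorem bside {F : Submodule ℂ (P2 × P2 → ℂ)} {θ : ℝ}
    (hF10 : finrank ℂ F = 10) (hB : finrank ℂ (TensorApolarity.prodB F) ≤ 34)
    (hθ : ∀ f ∈ F, (∑ c : P2, ‖∑ p : P2 × P2, f p * T2 c p.1 p.2‖ ^ 2) ≤ θ * ∑ p, ‖f p‖ ^ 2)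
    (hθ0 : 0 ≤ θ) (hθ1 : θ ≤ 1 / 10000) :
    ∃ ĥ' : V8, ‖ĥ'‖ = 1 ∧ ∀ ℓ ∈ (annT ⊓ perpTo F : Submodule ℂ V16),
      ‖ℓ‖ ^ 2 - ∑ w : Fin 2, ‖⟪sigmaV (uTensor w ĥ'), ℓ⟫_ℂ‖ ^ 2 ≤ 1 / 50 * ‖ℓ‖ ^ 2 := by
  have hF10' : finrank ℂ (sigmaF F) = 10 := by rw [finrank_sigmaF, hF10]
  have hA' : finrank ℂ (TensorApolarity.prodA (sigmaF F)) ≤ 34 := by rw [finrank_prodA_sigmaF]; exact hB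
  obtain ⟨ĥ', hĥ'1, hmain⟩ := aside hF10' hA' (defect_sigmaF hθ) hθ0 hθ1
  refine ⟨ĥ', hĥ'1, fun ℓ hℓ => ?_⟩
  have hσℓ : sigmaV ℓ ∈ (annT ⊓ perpTo (sigmaF F) : Submodule ℂ V16) :=
    ⟨sigmaV_mem_annT hℓ.1, sigmaV_mem_perpTo hℓ.2⟩
  have h := hmain _ hσℓ
  rw [norm_sigmaV] at h
  simp only [inner_sigmaV_left]
  simp only [← inner_sigmaV_left (uTensor _ ĥ'), ] at h
  convert h using 3
  simp only [inner_sigmaV_left]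

end Summit.MatrixMultiplication.MatrixMultiplication.Theorems.GapTwoSixExplicit

end
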